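import Mathlib.RingTheory.LocalRing.ResidueField.Basic
import Literature.NumberTheory.GaloisRepresentations.GaloisRep
import Literature.NumberTheory.Automorphic.AdicCompletionLocalField
import HarnessLib

/-!
# Ordinary representations of regular weight, residually upper-triangular integral models and
# `p`-distinguishedness (the Skinner–Wiles hypotheses)

Light vocabulary for the residually reducible, ordinary sector of two-dimensional `p`-adic Galois
representations (Skinner–Wiles, *Residually reducible representations and modular forms*,
Publ. Math. IHÉS 89 (1999)).  Everything here is a definition with a body or a proved lemma;
no fact is vendored.

* `FramedGaloisRep.IsOrdinaryOfWeight p ρ k m` — for a non-archimedean local field `L`, a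
  topological `ℤ_p`-algebra `A` and `ρ : Γ_L → GL₂(A)`: in some frame `Q ∈ GL₂(A)`,
  `Q⁻¹ ρ Q` is upper triangular, and on the inertia group `I_L = absInertia L` its lower-right
  entry `θ₂` satisfies `θ₂ ^ m = 1` and its upper-left entry `θ₁` satisfies
  `θ₁ ^ m = χ_p ^ ((k - 1) m)` (`χ_p = GaloisRep.cyclotomicCharacter L p`, mapped to `A` by
  `algebraMap ℤ_[p] A`): "`ρ ≅ (ψ₁ χ_p^{k-1} ∗ ; 0 ψ₂)` with `ψ₁, ψ₂` of finite order (dividing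
  `m`) on inertia", i.e. **ordinary of weight `k`** in the sense of Skinner–Wiles (§1, Theorem,
  hypotheses (ii) `ρ|_{I_p} ≅ (∗ ∗; 0 1)` and (iii) `det ρ = ψ ε^{k-1}`, `k ≥ 2`, `ψ` of finite
  order; §4.5 Main Theorem and Theorem A: `ρ|_{D_v} ≅ (ψ₁ ∗; 0 ψ₂)` with `ψ₂|_{I_v}` of finite
  order, `det ρ = ψ ε^{k-1}`).
* `FramedGaloisRep.IsOrdinaryOfWeightAt p ρ v k m` — for a number field `K` and a finite place
  `v`: `ρ.toLocal v : Γ_{K_v} → GL₂(A)` is ordinary of weight `k` with inertial exponent `m`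
  (local-field structure of `K_v = v.adicCompletion K` from
  `Literature.NumberTheory.Automorphic.AdicCompletionLocalField`).  For `A = ℚ̄_p = PadicAlgCl p`
  the unfolding `isOrdinaryOfWeightAt_iff_padicAlgCl` is, verbatim, the clause inlined in the
  items of route `Summits/Langlands/Langlands/Theses/EisensteinDefectOne.lean`.
* `IsResiduallyUpperTriangular ρ₀`, `residualDiag ρ₀ i`,
  `FramedRep.HasUpperTriangularIntegralModel ρ ρ₀` (and the requested specialisation
  `FramedGaloisRep.HasUpperTriangularIntegralModel`) — for a valuation subring `O ⊆ F` with
  maximal ideal `𝔪` and residue field `κ`: `ρ₀ : G → GL_n(O)` is an integral model of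
  `ρ : G → GL_n(F)` *in the same frame* (`GL_n(O) → GL_n(F)` maps `ρ₀` to `ρ`) whose reduction
  is upper triangular (`(ρ₀ g)ᵢⱼ ∈ 𝔪` for `j < i`), so that `ρ̄ = ρ₀ mod 𝔪` is reducible with
  diagonal characters `residualDiag ρ₀ i : G → κ` (multiplicative:
  `IsResiduallyUpperTriangular.residualChar`) and `ρ̄^ss = ⊕ᵢ residualDiag ρ₀ i`
  (Skinner–Wiles §1: "reduce `ρ` modulo a uniformizer … `ρ̄^ss` for the semisimplification";
  Serre, *Abelian ℓ-adic representations*, I.1.1).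
* `IsPDistinguishedAt ρ₀ v` — for `ρ₀ : Γ_K → GL₂(O)` and a finite place `v` of the number
  field `K`: the two residual diagonal characters differ on the decomposition group at `v`
  (the image of `Γ_{K_v}` under `absGaloisRestrict K K_v`): Skinner–Wiles' hypothesis
  "`(χ₁/χ₂)|_{D_v} ≠ 1`" (§1 Theorem (i), §4.5 Theorem A), "p-distinguished".

API (all proved): frame-change invariance (`isOrdinaryOfWeight_conj_iff`,
`isOrdinaryOfWeightAt_conj_iff`), monotonicity in `m` (`IsOrdinaryOfWeight.of_dvd`), the
rank-two unfoldings matching the route's inline clauses (`isResiduallyUpperTriangular_two_iff`,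
`FramedRep.hasUpperTriangularIntegralModel_two_iff`, `isPDistinguishedAt_iff`),
multiplicativity of the residual diagonal characters
(`IsResiduallyUpperTriangular.residualDiag_mul`) and `isPDistinguishedAt_iff_residualChar`.
Not here: the existence of a residually upper-triangular integral model for a residually
reducible `ρ : Γ_K → GL_n(ℚ̄_p)` (needs a model over a finite `E/ℚ_p`,
`Literature.NumberTheory.Automorphic.exists_hasQlModel`, then `exists_integralModel` over `𝒪_E`).

## Mathlib / Literature search

Mathlib has no ordinarity predicate for Galois representations and no residual representation
API (grep `[Oo]rdinary`, `UpperTriangular`, `[Dd]istinguished` over `Mathlib/NumberTheory`,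
`Mathlib/RepresentationTheory`: only `Matrix.BlockTriangular`, `Polynomial.IsDistinguishedAt`).
Reused: `Literature…FramedGaloisRep`, `FramedGaloisRep.toLocal`, `FramedRep.conj`,
`GaloisRep.cyclotomicCharacter`, `absInertia`, `absGaloisRestrict`, Mathlib's
`Matrix.GeneralLinearGroup.map`, `ValuationSubring`, `IsLocalRing.residue`, `PadicAlgCl`.
The integral models of `Literature…ResidualRepresentation` (`exists_integralModel`,
conjugate frame `P⁻¹ ρ P`) specialise to `HasUpperTriangularIntegralModel` after re-framing `ρ`.

## Design choices

* The prime `p` is an explicit argument (it cannot be inferred from `ρ`, `v`, `k`, `m`); the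
  coefficient ring is any topological commutative `ℤ_[p]`-algebra (`ℤ_p`, `ℚ_p`, `ℚ̄_p`, `𝒪_E`,
  Iwasawa algebras, deformation rings), the comparison with the `ℤ_[p]ˣ`-valued cyclotomic
  character being made through `algebraMap ℤ_[p] A`.
* The inertial conditions are the planner's "exponent `m`" form (`θ₂(σ)^m = 1`,
  `θ₁(σ)^m = χ_p(σ)^{(k-1)m}` for `σ ∈ I`), which for upper-triangular `Q⁻¹ρQ` (diagonal entries
  are then characters) says exactly that `θ₂|_I` and `(θ₁ χ_p^{1-k})|_I` have finite order
  dividing `m`; Skinner–Wiles' "finite order" is `∃ m ≥ 1`.  `k - 1` is `ℕ`-subtraction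
  (intended for `k ≥ 1`; the route takes `k ≥ 2`).
* `HasUpperTriangularIntegralModel` asks for equality `ρ₀ = ρ` in `GL_n(F)` (no conjugation):
  a framed representation can be re-framed (`FramedRep.conj`) beforehand, as the route does.

## References

* C. M. Skinner, A. J. Wiles, *Residually reducible representations and modular forms*,
  Publ. Math. IHÉS 89 (1999), 5–126: §1 (Theorem, hypotheses (i)–(iii)), §4.5 (Main Theorem,
  Theorems A and B). [SkinnerWiles1999]
* J.-P. Serre, *Abelian ℓ-adic representations and elliptic curves* (1968), Ch. I §1.1
  (lattices, reduction). [SerreAbelianLadic1968]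
-/

noncomputable section

open scoped NumberField MatrixGroups
open Field IsDedekindDomain IsLocalRing

namespace Literature.NumberTheory.GaloisRepresentations

/-! ### Ordinary of weight `k`: local definition -/

section OrdinaryLocal

variable {L : Type*} [Field L] [ValuativeRel L] [TopologicalSpace L] [IsNonarchimedeanLocalField L]
variable {A : Type*} [CommRing A] [TopologicalSpace A]
variable (p : ℕ) [Fact p.Prime] [Algebra ℤ_[p] A]

namespace FramedGaloisRep

/-- A two-dimensional representation `ρ : Γ_L → GL₂(A)` of a non-archimedean local field `L`
with coefficients in a topological `ℤ_p`-algebra `A` is **ordinary of weight `k` with inertial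
exponent `m`** if there is a frame `Q ∈ GL₂(A)` in which `Q⁻¹ ρ(σ) Q` is upper triangular for all
`σ ∈ Γ_L` and, for `σ` in the inertia group `I_L = absInertia L`, the lower-right entry `θ₂(σ)`
satisfies `θ₂(σ) ^ m = 1` and the upper-left entry `θ₁(σ)` satisfies
`θ₁(σ) ^ m = χ_p(σ) ^ ((k - 1) m)`, `χ_p = GaloisRep.cyclotomicCharacter L p` the `p`-adic
cyclotomic character (mapped into `A`): `ρ ≅ (ψ₁ χ_p^{k-1} ∗ ; 0 ψ₂)` with `ψ₁|_{I_L}, ψ₂|_{I_L}`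
of finite order dividing `m`.  This is the local shape in Skinner–Wiles' theorems ("ordinary":
`ρ|_{I_p} ≅ (∗ ∗ ; 0 1)` up to finite order, `det ρ = ψ ε^{k-1}`, `ψ` of finite order, `k ≥ 2`).
[cite: SkinnerWiles1999, §1 Theorem (ii)–(iii); §4.5 Main Theorem and Theorem A] -/
def IsOrdinaryOfWeight (ρ : FramedGaloisRep L A 2) (k m : ℕ) : Prop :=
  ∃ Q : GL (Fin 2) A, ∀ σ : absoluteGaloisGroup L,
    (Q⁻¹ * ρ σ * Q).val 1 0 = 0 ∧
    (σ ∈ absInertia L →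
      (Q⁻¹ * ρ σ * Q).val 1 1 ^ m = 1 ∧
      (Q⁻¹ * ρ σ * Q).val 0 0 ^ m =
        algebraMap ℤ_[p] A ((GaloisRep.cyclotomicCharacter L p σ : ℤ_[p]ˣ) : ℤ_[p]) ^
          ((k - 1) * m))

variable {p}

/-- Ordinarity of weight `k` is independent of the frame: it is invariant under conjugation
`ρ ↦ P ρ P⁻¹` (`FramedRep.conj`), the frame `Q` being replaced by `P Q`. [folklore] -/
theorem isOrdinaryOfWeight_conj_iff [IsTopologicalRing A] (P : GL (Fin 2) A)
    (ρ : FramedGaloisRep L A 2) (k m : ℕ) :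
    IsOrdinaryOfWeight p (FramedRep.conj P ρ) k m ↔ IsOrdinaryOfWeight p ρ k m := by
  constructor
  · rintro ⟨Q, hQ⟩
    refine ⟨P⁻¹ * Q, fun σ => ?_⟩
    have e : (P⁻¹ * Q)⁻¹ * ρ σ * (P⁻¹ * Q) = Q⁻¹ * FramedRep.conj P ρ σ * Q := by
      rw [FramedRep.conj_apply]; group
    rw [e]
    exact hQ σ
  · rintro ⟨Q, hQ⟩
    refine ⟨P * Q, fun σ => ?_⟩
    have e : (P * Q)⁻¹ * FramedRep.conj P ρ σ * (P * Q) = Q⁻¹ * ρ σ * Q := by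
      rw [FramedRep.conj_apply]; group
    rw [e]
    exact hQ σ

/-- Monotonicity in the inertial exponent: ordinary of weight `k` with exponent `m` implies
ordinary of weight `k` with exponent any multiple of `m`. [folklore] -/
theorem IsOrdinaryOfWeight.of_dvd {ρ : FramedGaloisRep L A 2} {k m m' : ℕ}
    (h : IsOrdinaryOfWeight p ρ k m) (hm : m ∣ m') : IsOrdinaryOfWeight p ρ k m' := by
  obtain ⟨d, rfl⟩ := hm
  obtain ⟨Q, hQ⟩ := h
  refine ⟨Q, fun σ => ⟨(hQ σ).1, fun hσ => ?_⟩⟩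
  obtain ⟨h1, h0⟩ := (hQ σ).2 hσ
  refine ⟨by rw [pow_mul, h1, one_pow], ?_⟩
  rw [pow_mul, h0, ← pow_mul, Nat.mul_assoc]

end FramedGaloisRep

end OrdinaryLocal

/-! ### Ordinary of weight `k` at a finite place of a number field -/

section OrdinaryGlobal

variable {K : Type*} [Field K] [NumberField K]
variable {A : Type*} [CommRing A] [TopologicalSpace A]
variable (p : ℕ) [Fact p.Prime] [Algebra ℤ_[p] A]

namespace FramedGaloisRep

/-- A two-dimensional representation `ρ : Γ_K → GL₂(A)` of a number field `K` is **ordinary of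
weight `k` (with inertial exponent `m`) at the finite place `v`** if its restriction
`ρ.toLocal v : Γ_{K_v} → GL₂(A)` to the decomposition group at `v` (`K_v = v.adicCompletion K`,
with its non-archimedean local field structure) is ordinary of weight `k` with inertial exponent
`m` (`IsOrdinaryOfWeight`): `ρ|_{D_v} ≅ (ψ₁ χ_p^{k-1} ∗ ; 0 ψ₂)` with `ψᵢ|_{I_v}` of finite
order dividing `m`.  Intended for `v ∣ p`.
[cite: SkinnerWiles1999, §1 Theorem (ii)–(iii); §4.5 Theorem A] -/
def IsOrdinaryOfWeightAt (ρ : FramedGaloisRep K A 2) (v : HeightOneSpectrum (𝓞 K))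
    (k m : ℕ) : Prop := IsOrdinaryOfWeight p (ρ.toLocal v) k m

/-- Unfolding lemma for `IsOrdinaryOfWeightAt`. [folklore] -/
theorem isOrdinaryOfWeightAt_iff (ρ : FramedGaloisRep K A 2) (v : HeightOneSpectrum (𝓞 K))
    (k m : ℕ) :
    IsOrdinaryOfWeightAt p ρ v k m ↔
      ∃ Q : GL (Fin 2) A, ∀ σ : absoluteGaloisGroup (v.adicCompletion K),
        (Q⁻¹ * ρ.toLocal v σ * Q).val 1 0 = 0 ∧
        (σ ∈ absInertia (v.adicCompletion K) →
          (Q⁻¹ * ρ.toLocal v σ * Q).val 1 1 ^ m = 1 ∧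
          (Q⁻¹ * ρ.toLocal v σ * Q).val 0 0 ^ m =
            algebraMap ℤ_[p] A
              ((GaloisRep.cyclotomicCharacter (v.adicCompletion K) p σ : ℤ_[p]ˣ) : ℤ_[p]) ^
                ((k - 1) * m)) :=
  Iff.rfl

variable {p} in
/-- Restriction to `Γ_{K_v}` commutes with change of frame. [folklore] -/
lemma toLocal_conj [IsTopologicalRing A] {n : ℕ} (P : GL (Fin n) A) (ρ : FramedGaloisRep K A n)
    (v : HeightOneSpectrum (𝓞 K)) :
    FramedGaloisRep.toLocal v (FramedRep.conj P ρ) = FramedRep.conj P (ρ.toLocal v) :=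
  ContinuousMonoidHom.ext fun _ => rfl

variable {p} in
/-- Ordinarity of weight `k` at `v` is invariant under change of frame `ρ ↦ P ρ P⁻¹`. [folklore] -/
theorem isOrdinaryOfWeightAt_conj_iff [IsTopologicalRing A] (P : GL (Fin 2) A)
    (ρ : FramedGaloisRep K A 2) (v : HeightOneSpectrum (𝓞 K)) (k m : ℕ) :
    IsOrdinaryOfWeightAt p (FramedRep.conj P ρ) v k m ↔ IsOrdinaryOfWeightAt p ρ v k m := by
  rw [IsOrdinaryOfWeightAt, toLocal_conj]
  exact isOrdinaryOfWeight_conj_iff P (ρ.toLocal v) k m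

variable {p} in
/-- Monotonicity of `IsOrdinaryOfWeightAt` in the inertial exponent. [folklore] -/
theorem IsOrdinaryOfWeightAt.of_dvd {ρ : FramedGaloisRep K A 2} {v : HeightOneSpectrum (𝓞 K)}
    {k m m' : ℕ} (h : IsOrdinaryOfWeightAt p ρ v k m) (hm : m ∣ m') :
    IsOrdinaryOfWeightAt p ρ v k m' :=
  IsOrdinaryOfWeight.of_dvd h hm

/-- For `ℚ̄_p`-coefficients (`A = PadicAlgCl p`, a `ℤ_[p]`-algebra through `ℚ_[p]`),
`IsOrdinaryOfWeightAt` is *verbatim* the ordinarity clause inlined in the items of route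
`EisensteinDefectOne` (cyclotomic character pushed along `ℤ_p ⊆ ℚ_p → ℚ̄_p`). [folklore] -/
theorem isOrdinaryOfWeightAt_iff_padicAlgCl (ρ : FramedGaloisRep K (PadicAlgCl p) 2)
    (v : HeightOneSpectrum (𝓞 K)) (k m : ℕ) :
    IsOrdinaryOfWeightAt p ρ v k m ↔
      ∃ Q : Matrix.GeneralLinearGroup (Fin 2) (PadicAlgCl p), ∀ σ,
        (Q⁻¹ * ρ.toLocal v σ * Q).val 1 0 = 0 ∧
        (σ ∈ absInertia (v.adicCompletion K) →
          (Q⁻¹ * ρ.toLocal v σ * Q).val 1 1 ^ m = 1 ∧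
          (Q⁻¹ * ρ.toLocal v σ * Q).val 0 0 ^ m =
            algebraMap (Padic p) (PadicAlgCl p)
              (((GaloisRep.cyclotomicCharacter (v.adicCompletion K) p σ).val : PadicInt p) :
                Padic p) ^ ((k - 1) * m)) := by
  have h : ∀ x : ℤ_[p],
      algebraMap ℤ_[p] (PadicAlgCl p) x = algebraMap ℚ_[p] (PadicAlgCl p) (x : ℚ_[p]) :=
    fun x => IsScalarTower.algebraMap_apply ℤ_[p] ℚ_[p] (PadicAlgCl p) x
  simp only [IsOrdinaryOfWeightAt, IsOrdinaryOfWeight, h]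

end FramedGaloisRep

end OrdinaryGlobal

/-! ### Residually upper-triangular integral models -/

section IntegralModel

variable {F : Type*} [Field F] {O : ValuationSubring F}
variable {G : Type*} [Group G] {n : ℕ}

/-- `ρ₀ : G → GL_n(O)` is **residually upper triangular**: every entry below the diagonal lies
in the maximal ideal `𝔪` of `O`, i.e. the reduction `ρ̄ = ρ₀ mod 𝔪 : G → GL_n(κ)` is upper
triangular (so `ρ̄` is reducible, with semisimplification the sum of its diagonal characters
`residualDiag ρ₀ i`).  For `n = 2` this is `(ρ₀ g)₁₀ ∈ 𝔪`
(`isResiduallyUpperTriangular_two_iff`).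
Ref: Skinner–Wiles (1999), §1 ("reduce `ρ` modulo a uniformizer … `ρ̄^ss = χ₁ ⊕ χ₂`") and §4.6,
proof of Theorem A (a basis with `ρ̄₁ = (1 ∗ ; 0 χ)`). [cite: SkinnerWiles1999, §1 and §4.6] -/
def IsResiduallyUpperTriangular (ρ₀ : G →* GL (Fin n) O) : Prop :=
  ∀ (g : G) (i j : Fin n), j < i → (ρ₀ g).val i j ∈ maximalIdeal O

/-- The `i`-th **residual diagonal entry** `g ↦ (ρ₀ g)ᵢᵢ mod 𝔪 ∈ κ = O/𝔪` of
`ρ₀ : G → GL_n(O)`.  When `ρ₀` is residually upper triangular these are the diagonal characters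
`χ̄ᵢ : G → κˣ` of `ρ̄ = ρ₀ mod 𝔪` (multiplicative: `IsResiduallyUpperTriangular.residualChar`),
and `ρ̄^ss = χ̄₁ ⊕ ⋯ ⊕ χ̄ₙ`.
Ref: Skinner–Wiles (1999), §1 (`ρ̄^ss = χ₁ ⊕ χ₂`). [cite: SkinnerWiles1999, §1] -/
def residualDiag (ρ₀ : G →* GL (Fin n) O) (i : Fin n) (g : G) : ResidueField O :=
  residue O ((ρ₀ g).val i i)

/-- `residualDiag ρ₀ i 1 = 1`. [folklore] -/
@[simp] lemma residualDiag_one (ρ₀ : G →* GL (Fin n) O) (i : Fin n) : residualDiag ρ₀ i 1 = 1 := by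
  simp [residualDiag]

/-- For a residually upper-triangular `ρ₀`, each residual diagonal entry is multiplicative:
`(ρ₀ (g g'))ᵢᵢ ≡ (ρ₀ g)ᵢᵢ (ρ₀ g')ᵢᵢ (mod 𝔪)` (the off-diagonal terms of the matrix product
have a factor below the diagonal). [folklore] -/
theorem IsResiduallyUpperTriangular.residualDiag_mul {ρ₀ : G →* GL (Fin n) O}
    (h : IsResiduallyUpperTriangular ρ₀) (i : Fin n) (g g' : G) :
    residualDiag ρ₀ i (g * g') = residualDiag ρ₀ i g * residualDiag ρ₀ i g' := by
  unfold residualDiag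
  rw [map_mul, Units.val_mul, Matrix.mul_apply, map_sum, Finset.sum_eq_single i, map_mul]
  · intro j _ hji
    rcases lt_or_gt_of_ne hji with hlt | hgt
    · exact (residue_eq_zero_iff _).mpr (Ideal.mul_mem_right _ _ (h g i j hlt))
    · exact (residue_eq_zero_iff _).mpr (Ideal.mul_mem_left _ _ (h g' j i hgt))
  · intro hi
    exact absurd (Finset.mem_univ i) hi

/-- The **residual diagonal characters** `χ̄ᵢ : G →* κ` of a residually upper-triangular
`ρ₀ : G → GL_n(O)` (the Jordan–Hölder constituents of `ρ̄ = ρ₀ mod 𝔪`, `ρ̄^ss = ⊕ᵢ χ̄ᵢ`).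
Ref: Skinner–Wiles (1999), §1. [cite: SkinnerWiles1999, §1] -/
def IsResiduallyUpperTriangular.residualChar {ρ₀ : G →* GL (Fin n) O}
    (h : IsResiduallyUpperTriangular ρ₀) (i : Fin n) : G →* ResidueField O where
  toFun := residualDiag ρ₀ i
  map_one' := residualDiag_one ρ₀ i
  map_mul' := h.residualDiag_mul i

/-- Unfolding lemma for `IsResiduallyUpperTriangular.residualChar`. [folklore] -/
@[simp] lemma IsResiduallyUpperTriangular.residualChar_apply {ρ₀ : G →* GL (Fin n) O}
    (h : IsResiduallyUpperTriangular ρ₀) (i : Fin n) (g : G) :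
    h.residualChar i g = residualDiag ρ₀ i g := rfl

/-- In rank two, residual upper-triangularity is the single condition `(ρ₀ g)₁₀ ∈ 𝔪`. [folklore] -/
theorem isResiduallyUpperTriangular_two_iff (ρ₀ : G →* GL (Fin 2) O) :
    IsResiduallyUpperTriangular ρ₀ ↔ ∀ g, (ρ₀ g).val 1 0 ∈ maximalIdeal O := by
  refine ⟨fun h g => h g 1 0 Fin.zero_lt_one, fun h g i j hij => ?_⟩
  have hij' : i = 1 ∧ j = 0 := by
    revert i j
    decide
  obtain ⟨rfl, rfl⟩ := hij'
  exact h g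

variable [TopologicalSpace F] [TopologicalSpace G]

/-- `ρ₀ : G → GL_n(O)` is a **residually upper-triangular integral model** of the framed
representation `ρ : G → GL_n(F)` (`O ⊆ F` a valuation subring with maximal ideal `𝔪`): `ρ₀`
maps to `ρ` under `GL_n(O) → GL_n(F)` (an integral model *in the same frame*: a stable lattice,
Serre I.1.1) and `ρ₀ mod 𝔪` is upper triangular (`IsResiduallyUpperTriangular`), so that `ρ̄^ss`
is the sum of the residual diagonal characters `residualDiag ρ₀ i` — the residually *reducible*
situation of Skinner–Wiles (§4.6, proof of Theorem A: "for some choice of basis `ρ₁` takes values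
in `GL₂(𝒪)` … `ρ̄₁ = (1 ∗ ; 0 χ)`").
[cite: SkinnerWiles1999, §4.6, proof of Theorem A] [cite: SerreAbelianLadic1968, Ch. I §1.1] -/
def FramedRep.HasUpperTriangularIntegralModel (ρ : FramedRep G F n)
    (ρ₀ : G →* GL (Fin n) O) : Prop :=
  (∀ g, Matrix.GeneralLinearGroup.map O.subtype (ρ₀ g) = ρ g) ∧ IsResiduallyUpperTriangular ρ₀

/-- Rank-two unfolding of `FramedRep.HasUpperTriangularIntegralModel`: `ρ₀ ↦ ρ` and
`(ρ₀ g)₁₀ ∈ 𝔪` for all `g` (verbatim the clauses inlined in route `EisensteinDefectOne`). [folklore] -/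
theorem FramedRep.hasUpperTriangularIntegralModel_two_iff (ρ : FramedRep G F 2)
    (ρ₀ : G →* GL (Fin 2) O) :
    FramedRep.HasUpperTriangularIntegralModel ρ ρ₀ ↔
      (∀ g, Matrix.GeneralLinearGroup.map O.subtype (ρ₀ g) = ρ g) ∧
        ∀ g, (ρ₀ g).val 1 0 ∈ maximalIdeal O :=
  and_congr Iff.rfl (isResiduallyUpperTriangular_two_iff ρ₀)

/-- An integral model in the same frame has the same characteristic polynomials:
`charpoly (ρ₀ g)` maps to `charpoly (ρ g)` under `O ⊆ F`. [folklore] -/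
theorem FramedRep.HasUpperTriangularIntegralModel.charpoly_map {ρ : FramedRep G F n}
    {ρ₀ : G →* GL (Fin n) O} (h : FramedRep.HasUpperTriangularIntegralModel ρ ρ₀) (g : G) :
    ((ρ₀ g).val.charpoly).map O.subtype = FramedRep.charpoly ρ g := by
  rw [FramedRep.charpoly, ← h.1 g, ← Matrix.charpoly_map]
  rfl

end IntegralModel

section IntegralModelGalois

variable {K : Type*} [Field K] {F : Type*} [Field F] [TopologicalSpace F] {O : ValuationSubring F}
  {n : ℕ}

/-- `FramedGaloisRep.HasUpperTriangularIntegralModel ρ ρ₀` (requested name): the Galois case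
`G = Γ_K` of `FramedRep.HasUpperTriangularIntegralModel` — `ρ₀ : Γ_K → GL_n(O)` is an integral
model of `ρ : Γ_K → GL_n(F)` in the same frame, upper triangular modulo `𝔪`.  Typical use:
`F = PadicAlgCl p`, `O = Valued.v.valuationSubring` (the valuation ring of `ℚ̄_p`).
[cite: SkinnerWiles1999, §4.6, proof of Theorem A] -/
protected abbrev FramedGaloisRep.HasUpperTriangularIntegralModel (ρ : FramedGaloisRep K F n)
    (ρ₀ : absoluteGaloisGroup K →* GL (Fin n) O) : Prop :=
  FramedRep.HasUpperTriangularIntegralModel ρ ρ₀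

end IntegralModelGalois

/-! ### `p`-distinguishedness -/

section Distinguished

variable {F : Type*} [Field F] {O : ValuationSubring F}
variable {K : Type*} [Field K] [NumberField K]

/-- `ρ₀ : Γ_K → GL₂(O)` is **`p`-distinguished at the finite place `v`** (for `v ∣ p`): the two
residual diagonal entries differ somewhere on the decomposition group at `v`, i.e. there is
`σ ∈ Γ_{K_v}` (`K_v = v.adicCompletion K`, mapped into `Γ_K` by `absGaloisRestrict K K_v`) with
`(ρ₀ σ)₀₀ ≢ (ρ₀ σ)₁₁ (mod 𝔪)`.  For residually upper-triangular `ρ₀` with residual diagonal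
characters `χ̄₁, χ̄₂` this is Skinner–Wiles' hypothesis `(χ̄₁/χ̄₂)|_{D_v} ≠ 1`
(`isPDistinguishedAt_iff_residualChar`).
[cite: SkinnerWiles1999, §1 Theorem (i); §4.5 Theorem A] -/
def IsPDistinguishedAt (ρ₀ : absoluteGaloisGroup K →* GL (Fin 2) O)
    (v : HeightOneSpectrum (𝓞 K)) : Prop :=
  ∃ σ : absoluteGaloisGroup (v.adicCompletion K),
    residualDiag ρ₀ 0 (absGaloisRestrict K (v.adicCompletion K) σ) ≠
      residualDiag ρ₀ 1 (absGaloisRestrict K (v.adicCompletion K) σ)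

/-- Unfolding of `IsPDistinguishedAt` as a non-congruence of matrix entries (verbatim the clause
inlined in route `EisensteinDefectOne`). [folklore] -/
theorem isPDistinguishedAt_iff (ρ₀ : absoluteGaloisGroup K →* GL (Fin 2) O)
    (v : HeightOneSpectrum (𝓞 K)) :
    IsPDistinguishedAt ρ₀ v ↔
      ∃ σ, (ρ₀ (absGaloisRestrict K (v.adicCompletion K) σ)).val 0 0 -
        (ρ₀ (absGaloisRestrict K (v.adicCompletion K) σ)).val 1 1 ∉ maximalIdeal O := by
  refine exists_congr fun σ => not_congr ?_
  rw [residualDiag, residualDiag, ← sub_eq_zero, ← map_sub, residue_eq_zero_iff]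

/-- For residually upper-triangular `ρ₀` with residual diagonal characters `χ̄₀, χ̄₁ : Γ_K →* κ`,
`p`-distinguishedness at `v` says `χ̄₀|_{Γ_{K_v}} ≠ χ̄₁|_{Γ_{K_v}}`. [folklore] -/
theorem isPDistinguishedAt_iff_residualChar {ρ₀ : absoluteGaloisGroup K →* GL (Fin 2) O}
    (h : IsResiduallyUpperTriangular ρ₀) (v : HeightOneSpectrum (𝓞 K)) :
    IsPDistinguishedAt ρ₀ v ↔
      (h.residualChar 0).comp (absGaloisRestrict K (v.adicCompletion K)).toMonoidHom ≠
        (h.residualChar 1).comp (absGaloisRestrict K (v.adicCompletion K)).toMonoidHom := by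
  rw [Ne, MonoidHom.ext_iff, not_forall]
  rfl

end Distinguished

end Literature.NumberTheory.GaloisRepresentations
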